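import Mathlib
import Summits.Langlands.Langlands.Theses.PhantomRMYoshida
import Literature.NumberTheory.GaloisRepresentations.SerreWeight
import Literature.NumberTheory.GaloisRepresentations.ResidualPair
import Literature.NumberTheory.GaloisRepresentations.ResidualPairIntegrality
import Literature.NumberTheory.GaloisRepresentations.FramedRepBaseChange
import Literature.NumberTheory.GaloisRepresentations.ArtinRestriction
import Literature.NumberTheory.Automorphic.AdicCompletionLocalField
import Literature.NumberTheory.Automorphic.GLnAdelicStructureProofs
import Literature.NumberTheory.DiophantineGeometry.AVGaloisModule
import Literature.NumberTheory.DiophantineGeometry.AVGaloisModuleContinuityProofs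
import Literature.NumberTheory.DiophantineGeometry.AVGaloisModuleTateRankOfCubeProofs
import Literature.NumberTheory.DiophantineGeometry.AbelianVarietyOrdinaryReduction
import Literature.FieldTheory.AlgClosed.PadicAlgClEquivComplex
import Literature.NumberTheory.DiophantineGeometry.WeilPairingRationalTateModule
import HarnessLib

/-!
# Route `PhantomRMYoshida`, crux `StableYoshidaCongruence` (stmt-Langlands-13640), line
# `level-three-weierstrass-switch`: the framed `H¹_ét(B_ℚ̄, ℚ̄_p)` of an abelian variety over `ℚ`

Support file for Stub 2 (`stub_switchToModularSurface`, file
`PhantomRMYoshidaStableYoshidaCongruenceSwitchToModularSurface.lean`, which imports this one): the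
vocabulary-free half of its dictionary.

* uses the published fact `Literature.NumberTheory.DiophantineGeometry.weilPairing_rationalTateModule`
  (Weil pairing of a polarisation makes `V_p B` symplectic with multiplier `χ_p`; Milne §16 / Mumford §20;
  landed as p86824 from this file's first submission);
* integral Frobenius polynomials from `ℤ_p[X]` to `ℤ̄_p[X]` (`padicIntToInteger`,
  `exists_integer_polynomial_of_padicInt`);
* `framedH1 p B b` — the framed contragredient of `V_p B ⊗ ℚ̄_p` in the dual basis of a `ℚ_p`-basis `b`
  (`framedH1_apply_val`: matrix of `g` = transpose of the matrix of `g⁻¹`, i.e. the line's `TateFrame`);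
* `isSymplectic_framedH1` — `framedH1` is symplectic with multiplier `ε⁻¹`, from the Weil fact
  (`inv_gram_identity`: inverse Gram matrix, inverse multiplier); packaged as the REGISTERED stub
  `stub_framedH1Symplectic` of the checked skeleton (reshape v5).

Worker `stub stub_switchToModularSurface` of lead prover-line-stmt-Langlands-13640-0 (2026-08-16); split off by
the lead to respect the 400-line limit.
-/

set_option linter.dupNamespace false

noncomputable section

open CategoryTheory IsDedekindDomain
open scoped NumberField Matrix
open Literature.NumberTheory.GaloisRepresentations Literature.NumberTheory.Automorphic
open Literature.AlgebraicGeometry.Motives (AbelianVariety)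
open Literature.NumberTheory.DiophantineGeometry (weilPairing_rationalTateModule)

namespace Summit.Langlands.Langlands.Cruxes.StableYoshidaCongruence.LevelThreeWeierstrassSwitch


/-! ## Dictionary lemmas, vocabulary-free half -/

section Dictionary

/-- A ring homomorphism out of `ℤ_p` into a ring of characteristic `p` is reduction mod `p`
followed by the canonical map `𝔽_p → R` (`x ≡ (x mod p) (mod p ℤ_p)`, Mathlib `PadicInt.toZMod_spec`). -/
theorem ringHom_padicInt_eq_castHom_comp_toZMod {p : ℕ} [Fact p.Prime] {R : Type*} [Ring R]
    [CharP R p] (φ : ℤ_[p] →+* R) :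
    φ = (ZMod.castHom (dvd_refl p) R).comp (PadicInt.toZMod (p := p)) := by
  refine RingHom.ext fun x => ?_
  have hx := PadicInt.toZMod_spec x
  rw [PadicInt.maximalIdeal_eq_span_p, Ideal.mem_span_singleton] at hx
  obtain ⟨y, hy⟩ := hx
  have hx' : x = ((PadicInt.toZMod x).cast : ℤ_[p]) + (p : ℤ_[p]) * y := by
    rw [← hy]; ring
  rw [RingHom.comp_apply, ZMod.castHom_apply]
  conv_lhs => rw [hx']
  rw [map_add, map_mul, map_natCast, CharP.cast_eq_zero R p, zero_mul, add_zero,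
    ZMod.cast_eq_val, map_natCast, ZMod.cast_eq_val]

/-! ### Integral Frobenius polynomials: from `ℤ₃[X]` to `ℤ̄₃[X]` -/

/-- The inclusion `ℤ_p → ℚ̄_p = PadicAlgCl p` lands in the valuation ring `ℤ̄_p = 𝒪[ℚ̄_p]`
(`‖x‖ ≤ 1` is preserved, Mathlib `PadicAlgCl.norm_extends`). -/
theorem algebraMap_padicInt_mem_integer {p : ℕ} [Fact p.Prime] (x : ℤ_[p]) :
    algebraMap ℤ_[p] (PadicAlgCl p) x ∈ Valued.integer (PadicAlgCl p) := by
  change Valued.v (algebraMap ℤ_[p] (PadicAlgCl p) x) ≤ 1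
  rw [IsScalarTower.algebraMap_apply ℤ_[p] ℚ_[p] (PadicAlgCl p), PadicAlgCl.valuation_def,
    ← NNReal.coe_le_coe, coe_nnnorm, NNReal.coe_one]
  change ‖((x : ℚ_[p]) : PadicAlgCl p)‖ ≤ 1
  rw [PadicAlgCl.norm_extends]
  exact PadicInt.norm_le_one x

/-- The ring homomorphism `ℤ_p → ℤ̄_p = 𝒪[ℚ̄_p]` (corestriction of `ℤ_p → ℚ̄_p`). -/
def padicIntToInteger (p : ℕ) [Fact p.Prime] : ℤ_[p] →+* Valued.integer (PadicAlgCl p) :=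
  (algebraMap ℤ_[p] (PadicAlgCl p)).codRestrict _ algebraMap_padicInt_mem_integer

/-- `ℤ_p → ℤ̄_p → ℚ̄_p` is `ℤ_p → ℚ̄_p`. -/
theorem subtype_comp_padicIntToInteger (p : ℕ) [Fact p.Prime] :
    (Valued.integer (PadicAlgCl p)).subtype.comp (padicIntToInteger p) =
      algebraMap ℤ_[p] (PadicAlgCl p) :=
  RingHom.ext fun _ => rfl

/-- Any reduction map `red : ℤ̄_p → k` to characteristic `p` restricts on `ℤ_p` to reduction
mod `p` followed by `𝔽_p → k` (`ringHom_padicInt_eq_castHom_comp_toZMod`). -/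
theorem red_comp_padicIntToInteger {p : ℕ} [Fact p.Prime] {k : Type*} [Field k] [CharP k p]
    (red : Valued.integer (PadicAlgCl p) →+* k) :
    red.comp (padicIntToInteger p) = (ZMod.castHom (dvd_refl p) k).comp (PadicInt.toZMod (p := p)) :=
  ringHom_padicInt_eq_castHom_comp_toZMod _

/-- **Integral lift.**  A polynomial `P ∈ ℤ_p[X]` whose image in `ℚ̄_p[X]` is `Q` and whose reduction
mod `p` is `Q̄ ∈ 𝔽_p[X]` gives `P' ∈ ℤ̄_p[X]` with image `Q` and with `red(P') = Q̄ ⊗ k` for every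
reduction map `red : ℤ̄_p → k` to characteristic `p`. -/
theorem exists_integer_polynomial_of_padicInt {p : ℕ} [Fact p.Prime] {k : Type*} [Field k]
    [CharP k p] (red : Valued.integer (PadicAlgCl p) →+* k) (P : Polynomial ℤ_[p]) :
    ∃ P' : Polynomial (Valued.integer (PadicAlgCl p)),
      P'.map (Valued.integer (PadicAlgCl p)).subtype = P.map (algebraMap ℤ_[p] (PadicAlgCl p)) ∧
      P'.map red = (P.map (PadicInt.toZMod (p := p))).map (ZMod.castHom (dvd_refl p) k) := by
  refine ⟨P.map (padicIntToInteger p), ?_, ?_⟩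
  · rw [Polynomial.map_map, subtype_comp_padicIntToInteger]
  · rw [Polynomial.map_map, red_comp_padicIntToInteger, Polynomial.map_map]

/-! ### The framed `H¹_ét(B_ℚ̄, ℚ̄_p)` of an abelian variety over `ℚ` -/

section H1

variable (p : ℕ) [Fact p.Prime]

/-- `(p : ℚ) ≠ 0` for a prime `p`. -/
theorem natCast_prime_ne_zero_rat : ((p : ℕ) : ℚ) ≠ 0 :=
  Nat.cast_ne_zero.2 (Fact.out : p.Prime).ne_zero

/-- `V_p B` with its continuous `Γ_ℚ`-action, as a `GaloisRep` (continuity: the tree's theorem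
`AbelianVariety.continuous_rationalTateRep_holds`). -/
def ratTateGaloisRep (B : AbelianVariety ℚ) : GaloisRep ℚ ℚ_[p] (B.rationalTateModule p) :=
  B.rationalTateGaloisRep p (B.continuous_rationalTateRep_holds p (natCast_prime_ne_zero_rat p))

/-- **The framed `H¹`.**  For a `ℚ_p`-basis `b` of `V_p B`: the framed representation
`Γ_ℚ →ₜ* GL_n(ℚ̄_p)` on `(V_p B)^∨ ⊗ ℚ̄_p = H¹_ét(B_ℚ̄, ℚ̄_p)` in the dual basis of `b` — the dual
(inverse transpose, `FramedRep.dual`) of the frame `[·]_b` (`ContinuousRep.frame`), pushed to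
`ℚ̄_p` (`FramedRep.baseChange`). -/
def framedH1 {n : ℕ} (B : AbelianVariety ℚ) (b : Module.Basis (Fin n) ℚ_[p] (B.rationalTateModule p)) :
    FramedGaloisRep ℚ (PadicAlgCl p) n :=
  FramedRep.baseChange (algebraMap ℚ_[p] (PadicAlgCl p)) (continuous_algebraMap_padicAlgCl p)
    (FramedRep.dual ((ratTateGaloisRep p B).frame b))

/-- The matrix of `framedH1 p B b` at `g` is the transpose of `[g⁻¹]_b`, mapped to `ℚ̄_p`
(by construction). -/
theorem framedH1_apply_val {n : ℕ} (B : AbelianVariety ℚ)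
    (b : Module.Basis (Fin n) ℚ_[p] (B.rationalTateModule p)) (g : Field.absoluteGaloisGroup ℚ) :
    (framedH1 p B b g).val =
      ((LinearMap.toMatrix b b (B.rationalTateRep p g⁻¹)).map (algebraMap ℚ_[p] (PadicAlgCl p)))ᵀ := by
  rw [← Matrix.transpose_map]
  rfl

end H1

/-! ### Symplecticity of the framed `H¹` from the Weil pairing -/

section Symplectic

variable {F : Type*} [Field F] {n : Type*} [Fintype n] [DecidableEq n]

/-- Matrix algebra behind "the dual of a symplectic representation is symplectic for the inverse
Gram matrix with the inverse multiplier": if `M M' = 1`, `Mᵀ J M = c • J`, `c c' = 1` and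
`det J ≠ 0`, then `M' J⁻¹ M'ᵀ = c' • J⁻¹`. -/
theorem inv_gram_identity {M M' J : Matrix n n F} {c c' : F} (hMM' : M * M' = 1)
    (hJ : J.det ≠ 0) (hE : Mᵀ * J * M = c • J) (hcc' : c * c' = 1) :
    M' * J⁻¹ * M'ᵀ = c' • J⁻¹ := by
  have hJu : IsUnit J.det := isUnit_iff_ne_zero.2 hJ
  -- `X (Mᵀ J M) = M' M = 1` where `X = M' J⁻¹ M'ᵀ`
  have h1 : M' * J⁻¹ * M'ᵀ * (Mᵀ * J * M) = M' * M := by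
    calc M' * J⁻¹ * M'ᵀ * (Mᵀ * J * M)
        = M' * J⁻¹ * (M * M')ᵀ * J * M := by
          rw [Matrix.transpose_mul]; simp only [Matrix.mul_assoc]
      _ = M' * M := by
          rw [hMM', Matrix.transpose_one, Matrix.mul_one, Matrix.mul_assoc M',
            Matrix.nonsing_inv_mul J hJu, Matrix.mul_one]
  have hM'M : M' * M = 1 := mul_eq_one_comm.1 hMM'
  rw [hE, hM'M, Matrix.mul_smul] at h1
  -- h1 : c • (X * J) = 1
  have h2 : M' * J⁻¹ * M'ᵀ * J = c' • (1 : Matrix n n F) := by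
    have := congrArg (fun A : Matrix n n F => c' • A) h1
    simp only [smul_smul, mul_comm c' c, hcc', one_smul] at this
    rw [this]
  calc M' * J⁻¹ * M'ᵀ = M' * J⁻¹ * M'ᵀ * J * J⁻¹ := by
        rw [Matrix.mul_assoc _ J, Matrix.mul_nonsing_inv J hJu, Matrix.mul_one]
    _ = c' • J⁻¹ := by rw [h2, Matrix.smul_mul, Matrix.one_mul]

variable (p : ℕ) [Fact p.Prime]

/-- **`H¹_ét(B_ℚ̄, ℚ̄_p)` is symplectic with multiplier `ε⁻¹`**, from the Weil pairing fact: if `e` is a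
non-degenerate alternating `Γ_ℚ`-form on `V_p B` with multiplier `χ_p` and Gram matrix `J` in the
basis `b`, then `framedH1 p B b` preserves `J⁻¹` up to the scalar `χ_p⁻¹`. -/
theorem isSymplectic_framedH1 (hWeil : weilPairing_rationalTateModule) {m : ℕ} (B : AbelianVariety ℚ)
    (b : Module.Basis (Fin m) ℚ_[p] (B.rationalTateModule p)) :
    (framedH1 p B b).IsSymplecticWithMultiplierFun (fun g => algebraMap ℚ_[p] (PadicAlgCl p)
      ((((GaloisRep.cyclotomicCharacter ℚ p g)⁻¹ : ℤ_[p]ˣ) : ℤ_[p]) : ℚ_[p])) := by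
  classical
  obtain ⟨e, halt, hnd, heq⟩ := hWeil B p (natCast_prime_ne_zero_rat p)
  set V := B.rationalTateRep p
  set J : Matrix (Fin m) (Fin m) ℚ_[p] := LinearMap.BilinForm.toMatrix b e with hJdef
  set f := algebraMap ℚ_[p] (PadicAlgCl p)
  set c : Field.absoluteGaloisGroup ℚ → ℚ_[p] :=
    fun g => (((GaloisRep.cyclotomicCharacter ℚ p g : ℤ_[p]ˣ) : ℤ_[p]) : ℚ_[p]) with hc
  -- the Gram matrix is alternating and invertible
  have hJt : Jᵀ = -J := by
    ext i j
    simp only [Matrix.transpose_apply, Matrix.neg_apply, hJdef, LinearMap.BilinForm.toMatrix_apply]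
    exact (halt.neg_eq (b i) (b j)).symm
  have hJdet : J.det ≠ 0 :=
    Matrix.nondegenerate_iff_det_ne_zero.1 ((LinearMap.BilinForm.nondegenerate_toMatrix_iff b).2 hnd)
  -- equivariance in the basis `b`
  have hE : ∀ g, (LinearMap.toMatrix b b (V g))ᵀ * J * LinearMap.toMatrix b b (V g) = c g • J := by
    intro g
    have hcomp : e.comp (V g) (V g) = c g • e := by
      refine LinearMap.ext fun x => LinearMap.ext fun y => ?_
      rw [LinearMap.BilinForm.comp_apply, LinearMap.smul_apply, LinearMap.smul_apply, smul_eq_mul]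
      exact heq g x y
    rw [hJdef, ← LinearMap.BilinForm.toMatrix_comp b b e (V g) (V g), hcomp, map_smul]
  have hMM' : ∀ g, LinearMap.toMatrix b b (V g) * LinearMap.toMatrix b b (V g⁻¹) = 1 := by
    intro g
    rw [← LinearMap.toMatrix_mul, ← map_mul, mul_inv_cancel, map_one, LinearMap.toMatrix_one]
  have hcc' : ∀ g, c g * c g⁻¹ = 1 := by
    intro g
    simp only [hc]
    rw [← PadicInt.coe_mul, ← Units.val_mul, ← map_mul, mul_inv_cancel, map_one, Units.val_one,
      PadicInt.coe_one]
  have hJu : IsUnit J.det := isUnit_iff_ne_zero.2 hJdet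
  have hJinvt : (J⁻¹)ᵀ = -J⁻¹ := by
    rw [Matrix.transpose_nonsing_inv, hJt]
    refine Matrix.inv_eq_right_inv ?_
    rw [neg_mul_neg, Matrix.mul_nonsing_inv J hJu]
  -- the inverse Gram matrix is preserved by the inverse-transpose matrices, multiplier `c⁻¹`
  have hdual : ∀ g, LinearMap.toMatrix b b (V g⁻¹) * J⁻¹ * (LinearMap.toMatrix b b (V g⁻¹))ᵀ =
      c g⁻¹ • J⁻¹ :=
    fun g => inv_gram_identity (hMM' g) hJdet (hE g) (hcc' g)
  -- the symplectic form for the dual: `J⁻¹`, mapped to `ℚ̄_p`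
  refine ⟨f.mapMatrix J⁻¹, ?_, ?_, fun g => ?_⟩
  · rw [RingHom.mapMatrix_apply, ← Matrix.transpose_map, hJinvt]
    exact (map_neg f.mapMatrix J⁻¹)
  · rw [← RingHom.map_det]
    exact (Matrix.isUnit_nonsing_inv_det J hJu).map f
  · have hval : (framedH1 p B b g).val = (f.mapMatrix (LinearMap.toMatrix b b (V g⁻¹)))ᵀ :=
      framedH1_apply_val p B b g
    rw [hval, Matrix.transpose_transpose, RingHom.mapMatrix_apply, RingHom.mapMatrix_apply,
      ← Matrix.transpose_map, ← Matrix.map_mul, ← Matrix.map_mul, hdual g,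
      Matrix.map_smul' _ _ _ (map_mul f)]
    congr 1


/-- **Registered stub `stub_framedH1Symplectic`** (checked skeleton, reshape v5): granted the Weil-pairing
fact, the framed `H¹_ét(B_ℚ̄, ℚ̄_p)` of any abelian variety over `ℚ`, in the dual basis of any `ℚ_p`-basis of
`V_p B`, is symplectic with multiplier `ε⁻¹` (= `isSymplectic_framedH1`).
[cite: Milne1986AbelianVarieties, §16 Lemma 16.1–16.2; MumfordAV1970, §20] -/
theorem stub_framedH1Symplectic :
    weilPairing_rationalTateModule →
    ∀ (p : ℕ) [Fact p.Prime] {m : ℕ} (B : AbelianVariety ℚ)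
      (b : Module.Basis (Fin m) ℚ_[p] (B.rationalTateModule p)),
      (framedH1 p B b).IsSymplecticWithMultiplierFun (fun g => algebraMap ℚ_[p] (PadicAlgCl p)
        ((((GaloisRep.cyclotomicCharacter ℚ p g)⁻¹ : ℤ_[p]ˣ) : ℤ_[p]) : ℚ_[p])) :=
  fun hWeil p _ _ B b => isSymplectic_framedH1 p hWeil B b

end Symplectic

end Dictionary

end Summit.Langlands.Langlands.Cruxes.StableYoshidaCongruence.LevelThreeWeierstrassSwitch
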